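import Summits.CriticalPhenomena.PercolationContinuityZ3.Theorems.Transplant.BoxProdZ2CubeInputs
import HarnessLib

/-!
# The θ-DEPENDENT INPUTS of the concentric construction as an explicit FINITE FAMILY of cylinder events (design (D), endgame "re-run at
# `q₀ < p`"; hypothesis (A) of stmt-g4's `BoxProdZ2ConcAssembly`): events, their finite edge supports, the bound `1 - δ` at `p`, and the
# unpacking into the standard estimates `hstd` / `hlink` consumed by the kit lemmas at the running parameter (`BoxProdZ2KitAtQ`)

builds on p205010 (kernel theorem, internal audit signed; external expert review pending) — nothing in this file uses p205010.
Lane `prim-bschramm`, seat `prim-bschramm-p3` (order I3 of V56); helper file (`--supports stmt-CriticalPhenomena-4575 --as helper`).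

The only places where `θ > 0` and almost-sure uniqueness enter the instance are the two clauses of `exists_scales` (p213256): the uniqueness
zone and the Lemma 9-prod link of the fat prisms `Λ^fat_M(τ) = B_X(τ, ψ M) × Λ_M`, `τ` in the finite set `V₀` of fibre representatives.  For a
finite set `S` of planar scales these are finitely many events, each determined by the pairs inside its prism:
* `inputEvent hT V₀ msel (τ, M, none) = zone Λ^fat(τ) (msel τ) M`, `inputEvent hT V₀ msel (τ, M, some g) = linkIn Λ^fat_M(τ) Λ^fat_{msel τ}(τ)
  (B_X(τ, ψ M) × piece g M)`; `inputEdges … (τ, M, _) = pairsF (Λ^fat_M(τ))`; `inputIndex V₀ S = V₀ ×ˢ S ×ˢ univ`;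
* `determinedBy_inputEvent`; **`exists_inputs_at_p`** (from `exists_scales`: inner sizes `msel`, a threshold `M₀`, and the bound `1 - δ <
  P_p(inputEvent i)` for every index over scales `≥ M₀`); **`hstd_of_inputs`** (the bounds at ANY parameter `q` give the `hstd` hypothesis of
  `kitClauseQ` / `kit_hIVQ` and the `hlink` hypothesis of `deep_h3Q` / `hcon_of_roomQ` / `link_seed_centerQ` at every scale of `S`).
[cite: KozmaNitzan2024, §4 p. 17 (Step I), Lemma 7 (p. 15), Lemma 9 (p. 16)] [cite: GrimmettPercolation1999, §7.2]
-/

noncomputable section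

open MeasureTheory

namespace Summit.CriticalPhenomena.PercolationContinuityZ3.Theorems

namespace Transplant

namespace BoxProdZ2

open Literature.Probability.Percolation Literature.Probability.LatticeModels SimpleGraph
open Literature.Probability.Percolation.KozmaNitzan
open Literature.Probability.Percolation.GM
open KNLevels

variable {W : Type} [DecidableEq W] (X : SimpleGraph W) [X.LocallyFinite]

/-- **The input events**: the uniqueness zone (`none`) and the Lemma 9-prod links to the eight quarter-pieces (`some g`) of the fat prism of
scale `M` at the representative `τ`. [cite: KozmaNitzan2024, §4 Lemma 7 (p. 15), Lemma 9 (p. 16)] -/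
def inputEvent [Countable W] {p : unitInterval} (hT : TubeSubcritical X p) (V₀ : Finset W) (msel : W → ℕ) :
    W × ℕ × Option (HOct 2) → Set (BondConfig (W × Site 2))
  | (τ, M, none) => UniqZone.zone (X □ zdGraph 2) (ufatSeq X hT V₀ τ) (msel τ) M
  | (τ, M, some g) => linkIn (↑(ufatSeq X hT V₀ τ M)) (ufatSeq X hT V₀ τ (msel τ)) (ballFin X τ (ufatRadius X hT V₀ M) ×ˢ piece g M)

/-- **The finite edge support** of an input event: the off-diagonal pairs inside the fat prism of its scale. [folklore] -/
def inputEdges [Countable W] {p : unitInterval} (hT : TubeSubcritical X p) (V₀ : Finset W) (i : W × ℕ × Option (HOct 2)) :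
    Finset (Sym2 (W × Site 2)) :=
  KNLevels.pairsF (ufatSeq X hT V₀ i.1 i.2.1)

omit [DecidableEq W] [X.LocallyFinite] in
/-- **The finite index set** of the inputs at the representatives `V₀` and the planar scales `S`. [folklore] -/
def inputIndex (V₀ : Finset W) (S : Finset ℕ) : Finset (W × ℕ × Option (HOct 2)) := V₀ ×ˢ (S ×ˢ Finset.univ)

omit [DecidableEq W] [X.LocallyFinite] in
/-- Membership in the index set. [folklore] -/
theorem mem_inputIndex_iff {V₀ : Finset W} {S : Finset ℕ} {i : W × ℕ × Option (HOct 2)} :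
    i ∈ inputIndex V₀ S ↔ i.1 ∈ V₀ ∧ i.2.1 ∈ S := by
  simp [inputIndex, Finset.mem_product]

/-- **Every input event is determined by the pairs inside its prism** (a cylinder event on finitely many coordinates). [folklore] -/
theorem determinedBy_inputEvent [Countable W] {p : unitInterval} (hT : TubeSubcritical X p) (V₀ : Finset W) (msel : W → ℕ)
    (i : W × ℕ × Option (HOct 2)) : DeterminedBy (inputEvent X hT V₀ msel i) (↑(inputEdges X hT V₀ i) : Set (Sym2 (W × Site 2))) := by
  obtain ⟨τ, M, og⟩ := i
  rcases og with _ | g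
  · exact determinedBy_zone _ _ _ (by rw [inputEdges, KNLevels.coe_pairsF])
  · exact determinedBy_linkIn _ _ _ (by rw [inputEdges, KNLevels.coe_pairsF])

/-- **The inputs hold at `p`** (Step I of Kozma–Nitzan for the product cubes, `exists_scales`): given `θ > 0`, a.s. uniqueness,
`TubeSubcritical` and `δ > 0`, there are inner sizes `msel τ ≥ m₀` and a threshold `M₀ > msel τ` such that for every finite set `S` of
scales `≥ M₀` every input event over `V₀ × S` has probability `> 1 - δ` at `p`. [cite: KozmaNitzan2024, §4 p. 17 (Step I)] -/
theorem exists_inputs_at_p [Countable W] {Δ : ℕ} (hΔ : ∀ w, X.degree w ≤ Δ) (hX : X.Connected) {p : unitInterval} (hp1 : (p : ℝ) < 1)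
    {z : W × Site 2} (hθ : 0 < theta (X □ zdGraph 2) z p) (hT : TubeSubcritical X p)
    (hU : ∀ᵐ ω ∂(bondPercolation (X □ zdGraph 2) p), numInfiniteClusters ω ≤ 1)
    (V₀ : Finset W) {δ : ℝ} (hδ : 0 < δ) (m₀ : ℕ) :
    ∃ (msel : W → ℕ) (M₀ : ℕ), (∀ τ ∈ V₀, m₀ ≤ msel τ ∧ msel τ < M₀) ∧
      ∀ S : Finset ℕ, (∀ M ∈ S, M₀ ≤ M) → ∀ i ∈ inputIndex V₀ S,
        1 - δ < (bondPercolation (X □ zdGraph 2) p).real (inputEvent X hT V₀ msel i) := by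
  obtain ⟨msel, M₀, hmsel, hstd⟩ := exists_scales X hΔ hX hp1 hθ hT hU V₀ hδ m₀
  refine ⟨msel, M₀, hmsel, fun S hS i hi => ?_⟩
  obtain ⟨τ, M, og⟩ := i
  obtain ⟨hτ, hM⟩ := mem_inputIndex_iff.1 hi
  obtain ⟨hzone, hlink⟩ := hstd M (hS M hM) τ hτ
  rcases og with _ | g
  · exact hzone
  · exact hlink g

/-- **Unpacking the inputs at a running parameter `q`**: if every input event over `V₀ × S` has probability `> 1 - δ` at `q`, then at every
scale `M ∈ S` the standard estimates hold at `q` — the `hstd` hypothesis of `kitClauseQ` / `kit_hIVQ` (both clauses) and the `hlink`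
hypothesis of `deep_h3Q` / `hcon_of_roomQ` / `link_seed_centerQ` (second clause). [folklore] -/
theorem hstd_of_inputs [Countable W] {p : unitInterval} (hT : TubeSubcritical X p) (V₀ : Finset W) (msel : W → ℕ) {S : Finset ℕ}
    {q : unitInterval} {δ : ℝ}
    (h : ∀ i ∈ inputIndex V₀ S, 1 - δ < (bondPercolation (X □ zdGraph 2) q).real (inputEvent X hT V₀ msel i)) {M : ℕ} (hM : M ∈ S) :
    ∀ τ ∈ V₀,
      1 - δ < (bondPercolation (X □ zdGraph 2) q).real (UniqZone.zone (X □ zdGraph 2) (ufatSeq X hT V₀ τ) (msel τ) M) ∧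
      ∀ g : HOct 2, 1 - δ < (bondPercolation (X □ zdGraph 2) q).real
        (linkIn (↑(ufatSeq X hT V₀ τ M)) (ufatSeq X hT V₀ τ (msel τ)) (ballFin X τ (ufatRadius X hT V₀ M) ×ˢ piece g M)) :=
  fun τ hτ => ⟨h (τ, M, none) (mem_inputIndex_iff.2 ⟨hτ, hM⟩), fun g => h (τ, M, some g) (mem_inputIndex_iff.2 ⟨hτ, hM⟩)⟩

end BoxProdZ2

end Transplant

end Summit.CriticalPhenomena.PercolationContinuityZ3.Theorems

end
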